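/-
Copyright: seat `ym-line-cbag-p2` (prover-ym-line-cbag-p2-g0-0), route `ColdBoxAllGroups`, crux `BulkAllGroups`
(stmt-QuantumFields-22255), line `dlr-chessboard-G` (skeleton `Cruxes/BulkAllGroups/Lines/birth.lean`).
-/
import Summits.QuantumFields.YangMills.Theorems.ColdBoxAllGroupsBulkAllGroupsKernelCovCore2G
import Summits.QuantumFields.YangMills.Theorems.WeakCouplingRatesBulkDominatesColdBoxWKernelCovCoreMoments

/-!
# Crux `BulkAllGroups` (stmt-QuantumFields-22255), stub `stub_kernelCovExpansionG`: the A-cov core with the Gaussian moment hypotheses and the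
# global YM bound DISCHARGED, any compact `G`, `D` colours — G-port of `…BulkDominatesColdBoxWKernelCovCoreMoments`

`abs_kernelCovG_sub_gaussian_le_core₂` (`…KernelCovCore2G`) takes the Gaussian moment data `K, K'`, `MemLp (Q₁Q₂) 2` and the global bound
`|βc| ≤ M₀` as hypotheses.  Here they are discharged once and for all for `D` colours and a unitary `ρ` of degree `N`: `M₀ = 2N|β|`
(`abs_plaqCostAt_leG`), `∫Q_i² ≤ K²` with `K² = 2D·Σ_c(F_c⁴ + 3C_pp²) + 2D·Σ_c(G_c⁴ + 3C_qq²)` (`integral_quadObs_sq_piD_le`), `MemLp (Q₁Q₂) 2` and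
`∫(Q₁Q₂)² ≤ K'²`, `K'² = (8D³Σ_c(F_c⁸ + 105C_pp⁴) + 8D³Σ_c(G_c⁸ + 105C_qq⁴))/2` (`integral_quadObs_pow_four_piD_le`, proved here: pointwise
`(Σ_c Y_c)⁴ ≤ D³ Σ_c Y_c⁴` — the sibling line's `pow_four_sum_le` — and the one-colour shifted eighth moment `integral_const_add_dirCirc_pow_eight_le`;
`memLp_two_mul_of_integrable_pow_four`).  What remains abstract in `abs_kernelCovG_sub_gaussian_le_moments`: the YM good event `E` with
`γ(·|ω)(Eᶜ) ≤ pY`, the chart map / Gaussian good event / tilt `cfg, S, W` with the three representation identities, the on-`S` bound `M`, the surrogate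
accuracy `τ`, the tilt bound `w`, and the Gaussian bad mass `p`.  No new definition; standard axioms.  NOT a claim about the mass gap; the Yang–Mills
mass gap is NOT proved by any of this.
-/

set_option autoImplicit false

noncomputable section

open MeasureTheory ProbabilityTheory Finset
open Literature.Probability.LatticeModels Literature.MathematicalPhysics.QuantumLattice
open Literature.MathematicalPhysics.QuantumFieldTheory
open Summit.QuantumFields.YangMills.Theorems.WeakCouplingRates

namespace Summit.QuantumFields.YangMills.Theorems.ColdBoxAllGroups

/-! ## The `D`-colour fourth moment of the quadratic observable -/

section Moments

variable {H D : ℕ}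

/-- The fourth power of the `D`-colour quadratic observable is integrable, and
**`E_{D1'^{⊗D}}[(½Σ_c (F_c + X_q(t_c))²)⁴] ≤ 8D³·Σ_c (F_c⁸ + 105V_D(q)⁴)`** (`(Σ_c Y_c)⁴ ≤ D³Σ_c Y_c⁴`, `E(F+X)⁸ ≤ 128(F⁸ + 105V⁴)`). [folklore] -/
theorem integral_quadObs_pow_four_piD_le (F : Fin D → ℝ) (q : Plaq 4) :
    Integrable (fun t : Fin D → EuclideanSpace ℝ (DirFree H) => ((1 / 2 : ℝ) * ∑ c, (F c + dirCirc H q (t c)) ^ 2) ^ 4)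
        (Measure.pi fun _ : Fin D => boxDirichlet H) ∧
      ∫ t : Fin D → EuclideanSpace ℝ (DirFree H), ((1 / 2 : ℝ) * ∑ c, (F c + dirCirc H q (t c)) ^ 2) ^ 4
          ∂(Measure.pi fun _ : Fin D => boxDirichlet H) ≤ 8 * (D : ℝ) ^ 3 * ∑ c, (F c ^ 8 + 105 * boxDirProjKernel H q q ^ 4) := by
  set PD := Measure.pi fun _ : Fin D => boxDirichlet H with hPD
  have h8 : ∀ c : Fin D, Integrable (fun t : Fin D → EuclideanSpace ℝ (DirFree H) => (F c + dirCirc H q (t c)) ^ 8) PD := fun c =>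
    integrable_comp_eval_piD (integrable_const_add_dirCirc_pow_eight (F c) q) c
  have hpt : ∀ t : Fin D → EuclideanSpace ℝ (DirFree H),
      ((1 / 2 : ℝ) * ∑ c, (F c + dirCirc H q (t c)) ^ 2) ^ 4 ≤ (D : ℝ) ^ 3 / 16 * ∑ c, (F c + dirCirc H q (t c)) ^ 8 := by
    intro t
    have h := pow_four_sum_le (D := D) (fun c => (F c + dirCirc H q (t c)) ^ 2)
    have e : ∀ c, ((F c + dirCirc H q (t c)) ^ 2) ^ 4 = (F c + dirCirc H q (t c)) ^ 8 := fun c => by ring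
    simp only [e] at h
    calc ((1 / 2 : ℝ) * ∑ c, (F c + dirCirc H q (t c)) ^ 2) ^ 4 = (∑ c, (F c + dirCirc H q (t c)) ^ 2) ^ 4 / 16 := by ring
      _ ≤ ((D : ℝ) ^ 3 * ∑ c, (F c + dirCirc H q (t c)) ^ 8) / 16 := div_le_div_of_nonneg_right h (by norm_num)
      _ = (D : ℝ) ^ 3 / 16 * ∑ c, (F c + dirCirc H q (t c)) ^ 8 := by ring
  have hmeas : AEStronglyMeasurable (fun t : Fin D → EuclideanSpace ℝ (DirFree H) => ((1 / 2 : ℝ) * ∑ c, (F c + dirCirc H q (t c)) ^ 2) ^ 4) PD :=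
    (memLp_two_quadObs_piD F q).aestronglyMeasurable.pow 4
  have hint : Integrable (fun t : Fin D → EuclideanSpace ℝ (DirFree H) => ((1 / 2 : ℝ) * ∑ c, (F c + dirCirc H q (t c)) ^ 2) ^ 4) PD := by
    refine Integrable.mono' ((integrable_finsetSum Finset.univ fun c _ => h8 c).const_mul ((D : ℝ) ^ 3 / 16)) hmeas (ae_of_all _ fun t => ?_)
    rw [Real.norm_eq_abs, abs_of_nonneg (by positivity)]
    exact hpt t
  refine ⟨hint, ?_⟩
  have hD0 : (0 : ℝ) ≤ (D : ℝ) ^ 3 / 16 := by positivity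
  calc ∫ t, ((1 / 2 : ℝ) * ∑ c, (F c + dirCirc H q (t c)) ^ 2) ^ 4 ∂PD
      ≤ ∫ t, (D : ℝ) ^ 3 / 16 * ∑ c, (F c + dirCirc H q (t c)) ^ 8 ∂PD :=
        integral_mono hint ((integrable_finsetSum Finset.univ fun c _ => h8 c).const_mul _) hpt
    _ = (D : ℝ) ^ 3 / 16 * ∑ c, ∫ s, (F c + dirCirc H q s) ^ 8 ∂(boxDirichlet H) := by
        rw [integral_const_mul, integral_finsetSum _ fun c _ => h8 c]
        congr 1
        exact Finset.sum_congr rfl fun c _ => integral_pi_eval (boxDirichlet H) (fun s => (F c + dirCirc H q s) ^ 8) c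
    _ ≤ (D : ℝ) ^ 3 / 16 * ∑ c, 128 * (F c ^ 8 + 105 * boxDirProjKernel H q q ^ 4) := by
        refine mul_le_mul_of_nonneg_left (Finset.sum_le_sum fun c _ => ?_) hD0
        exact integral_const_add_dirCirc_pow_eight_le (F c) q
    _ = 8 * (D : ℝ) ^ 3 * ∑ c, (F c ^ 8 + 105 * boxDirProjKernel H q q ^ 4) := by rw [← Finset.mul_sum]; ring

end Moments

/-! ## The A-cov core with moments discharged -/

variable {N : ℕ} {G : Type*} [Group G] [TopologicalSpace G] [IsTopologicalGroup G] [CompactSpace G]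
  [MeasurableSpace G] [BorelSpace G] [SecondCountableTopology G]
variable (ρ : G →* Matrix (Fin N) (Fin N) ℂ) (hρu : ∀ g, ρ g ∈ Matrix.unitaryGroup (Fin N) ℂ) (hρc : Continuous ρ)
include hρu hρc

/-- **A-cov core, moments discharged, any compact `G`, unitary `ρ` of degree `N`, `D` colours.**  See the module docstring; `K`, `K'` are the explicit
square roots named there, `M₀ = 2N|β|`. [folklore] -/
theorem abs_kernelCovG_sub_gaussian_le_moments {H D : ℕ} {β : ℝ} (ω : LGConfig 4 G)
    (x y : Site 4) (i j k l : Fin 4)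
    {E : Set (LGConfig 4 G)} (hE : MeasurableSet E) (hE0 : boxKernelG ρ β H ω E ≠ 0)
    {pY : ℝ} (hpY : (boxKernelG ρ β H ω).real Eᶜ ≤ pY) {M : ℝ} (hM : 0 ≤ M)
    (cfg : (Fin D → EuclideanSpace ℝ (DirFree H)) → LGConfig 4 G) (hcfg : Measurable cfg)
    {S : Set (Fin D → EuclideanSpace ℝ (DirFree H))} (hS : MeasurableSet S) (hS0 : (Measure.pi fun _ : Fin D => boxDirichlet H) S ≠ 0)
    {p : ℝ} (hp : (Measure.pi fun _ : Fin D => boxDirichlet H).real Sᶜ ≤ p)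
    {W : (Fin D → EuclideanSpace ℝ (DirFree H)) → ℝ} (hWm : Measurable W) {w : ℝ} (hW : ∀ t, |S.indicator W t| ≤ w)
    (hRepF : ∫ U, β * plaqCostAt ρ x i j U ∂((boxKernelG ρ β H ω)[|E]) =
      ∫ t, β * plaqCostAt ρ x i j (cfg t)
        ∂(((Measure.pi fun _ : Fin D => boxDirichlet H)[|S]).tilted (S.indicator W)))
    (hRepG : ∫ U, β * plaqCostAt ρ y k l U ∂((boxKernelG ρ β H ω)[|E]) =
      ∫ t, β * plaqCostAt ρ y k l (cfg t)
        ∂(((Measure.pi fun _ : Fin D => boxDirichlet H)[|S]).tilted (S.indicator W)))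
    (hRepFG : ∫ U, β * plaqCostAt ρ x i j U * (β * plaqCostAt ρ y k l U)
        ∂((boxKernelG ρ β H ω)[|E]) =
      ∫ t, β * plaqCostAt ρ x i j (cfg t) * (β * plaqCostAt ρ y k l (cfg t))
        ∂(((Measure.pi fun _ : Fin D => boxDirichlet H)[|S]).tilted (S.indicator W)))
    (F G' : Fin D → ℝ) (p' q' : Plaq 4) {τ : ℝ} (hτ : 0 ≤ τ)
    (hFS : ∀ t ∈ S, 0 ≤ β * plaqCostAt ρ x i j (cfg t) ∧ β * plaqCostAt ρ x i j (cfg t) ≤ M)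
    (hGS : ∀ t ∈ S, 0 ≤ β * plaqCostAt ρ y k l (cfg t) ∧ β * plaqCostAt ρ y k l (cfg t) ≤ M)
    (hSurF : ∀ t ∈ S, |β * plaqCostAt ρ x i j (cfg t) - (1 / 2 : ℝ) * ∑ c, (F c + dirCirc H p' (t c)) ^ 2| ≤ τ)
    (hSurG : ∀ t ∈ S, |β * plaqCostAt ρ y k l (cfg t) - (1 / 2 : ℝ) * ∑ c, (G' c + dirCirc H q' (t c)) ^ 2| ≤ τ) :
    |β ^ 2 * ((∫ U, plaqCostAt ρ x i j U * plaqCostAt ρ y k l U ∂(boxKernelG ρ β H ω)) -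
          (∫ U, plaqCostAt ρ x i j U ∂(boxKernelG ρ β H ω)) *
            (∫ U, plaqCostAt ρ y k l U ∂(boxKernelG ρ β H ω))) -
        ((D : ℝ) / 2 * boxDirProjKernel H p' q' ^ 2 + (∑ c, F c * G' c) * boxDirProjKernel H p' q')| ≤
      6 * (2 * N * |β|) * (2 * N * |β|) * pY +
        (3 * M ^ 2 * (Real.exp (2 * w) - 1) + 6 * M ^ 2 * p +
          2 * τ * (M + Real.sqrt (2 * D * ∑ c, (F c ^ 4 + 3 * boxDirProjKernel H p' p' ^ 2) +
            2 * D * ∑ c, (G' c ^ 4 + 3 * boxDirProjKernel H q' q' ^ 2))) +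
          Real.sqrt p * (2 * M * Real.sqrt (2 * D * ∑ c, (F c ^ 4 + 3 * boxDirProjKernel H p' p' ^ 2) +
              2 * D * ∑ c, (G' c ^ 4 + 3 * boxDirProjKernel H q' q' ^ 2)) +
            Real.sqrt ((8 * (D : ℝ) ^ 3 * ∑ c, (F c ^ 8 + 105 * boxDirProjKernel H p' p' ^ 4) +
              8 * (D : ℝ) ^ 3 * ∑ c, (G' c ^ 8 + 105 * boxDirProjKernel H q' q' ^ 4)) / 2) +
            (2 * D * ∑ c, (F c ^ 4 + 3 * boxDirProjKernel H p' p' ^ 2) + 2 * D * ∑ c, (G' c ^ 4 + 3 * boxDirProjKernel H q' q' ^ 2)))) := by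
  -- the global YM bound
  have hN0 : (0 : ℝ) ≤ N := Nat.cast_nonneg _
  have hfM : ∀ U, |β * plaqCostAt ρ x i j U| ≤ 2 * N * |β| := fun U => by
    rw [abs_mul]; nlinarith [abs_plaqCostAt_leG ρ hρu x i j U, abs_nonneg β, abs_nonneg (plaqCostAt ρ x i j U)]
  have hgM : ∀ U, |β * plaqCostAt ρ y k l U| ≤ 2 * N * |β| := fun U => by
    rw [abs_mul]; nlinarith [abs_plaqCostAt_leG ρ hρu y k l U, abs_nonneg β, abs_nonneg (plaqCostAt ρ y k l U)]
  -- nonnegativity of the moment constants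
  have h4e : Even 4 := by decide
  have h8e : Even 8 := by decide
  have hD0 : (0 : ℝ) ≤ D := Nat.cast_nonneg _
  have hA0 : 0 ≤ 2 * (D : ℝ) * ∑ c, (F c ^ 4 + 3 * boxDirProjKernel H p' p' ^ 2) :=
    mul_nonneg (by positivity) (Finset.sum_nonneg fun c _ =>
      add_nonneg (h4e.pow_nonneg _) (mul_nonneg (by norm_num) (sq_nonneg _)))
  have hB0 : 0 ≤ 2 * (D : ℝ) * ∑ c, (G' c ^ 4 + 3 * boxDirProjKernel H q' q' ^ 2) :=
    mul_nonneg (by positivity) (Finset.sum_nonneg fun c _ =>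
      add_nonneg (h4e.pow_nonneg _) (mul_nonneg (by norm_num) (sq_nonneg _)))
  have hAB0 : 0 ≤ 2 * (D : ℝ) * ∑ c, (F c ^ 4 + 3 * boxDirProjKernel H p' p' ^ 2) + 2 * D * ∑ c, (G' c ^ 4 + 3 * boxDirProjKernel H q' q' ^ 2) := by
    linarith
  have hA'0 : 0 ≤ 8 * (D : ℝ) ^ 3 * ∑ c, (F c ^ 8 + 105 * boxDirProjKernel H p' p' ^ 4) :=
    mul_nonneg (by positivity) (Finset.sum_nonneg fun c _ =>
      add_nonneg (h8e.pow_nonneg _) (mul_nonneg (by norm_num) (h4e.pow_nonneg _)))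
  have hB'0 : 0 ≤ 8 * (D : ℝ) ^ 3 * ∑ c, (G' c ^ 8 + 105 * boxDirProjKernel H q' q' ^ 4) :=
    mul_nonneg (by positivity) (Finset.sum_nonneg fun c _ =>
      add_nonneg (h8e.pow_nonneg _) (mul_nonneg (by norm_num) (h4e.pow_nonneg _)))
  have hAB'0 : 0 ≤ (8 * (D : ℝ) ^ 3 * ∑ c, (F c ^ 8 + 105 * boxDirProjKernel H p' p' ^ 4) +
      8 * (D : ℝ) ^ 3 * ∑ c, (G' c ^ 8 + 105 * boxDirProjKernel H q' q' ^ 4)) / 2 := by linarith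
  -- second moments
  have hK₁ : ∫ t, ((1 / 2 : ℝ) * ∑ c, (F c + dirCirc H p' (t c)) ^ 2) ^ 2 ∂(Measure.pi fun _ : Fin D => boxDirichlet H) ≤
      Real.sqrt (2 * D * ∑ c, (F c ^ 4 + 3 * boxDirProjKernel H p' p' ^ 2) + 2 * D * ∑ c, (G' c ^ 4 + 3 * boxDirProjKernel H q' q' ^ 2)) ^ 2 := by
    rw [Real.sq_sqrt hAB0]; exact (integral_quadObs_sq_piD_le (H := H) F p').trans (by linarith)
  have hK₂ : ∫ t, ((1 / 2 : ℝ) * ∑ c, (G' c + dirCirc H q' (t c)) ^ 2) ^ 2 ∂(Measure.pi fun _ : Fin D => boxDirichlet H) ≤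
      Real.sqrt (2 * D * ∑ c, (F c ^ 4 + 3 * boxDirProjKernel H p' p' ^ 2) + 2 * D * ∑ c, (G' c ^ 4 + 3 * boxDirProjKernel H q' q' ^ 2)) ^ 2 := by
    rw [Real.sq_sqrt hAB0]; exact (integral_quadObs_sq_piD_le (H := H) G' q').trans (by linarith)
  -- fourth moments ⇒ the product is in L² with controlled second moment
  obtain ⟨hI₁, h4₁⟩ := integral_quadObs_pow_four_piD_le (H := H) F p'
  obtain ⟨hI₂, h4₂⟩ := integral_quadObs_pow_four_piD_le (H := H) G' q'
  have hm₁ : AEStronglyMeasurable (fun t : Fin D → EuclideanSpace ℝ (DirFree H) => (1 / 2 : ℝ) * ∑ c, (F c + dirCirc H p' (t c)) ^ 2)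
      (Measure.pi fun _ : Fin D => boxDirichlet H) := (memLp_two_quadObs_piD (H := H) F p').aestronglyMeasurable
  have hm₂ : AEStronglyMeasurable (fun t : Fin D → EuclideanSpace ℝ (DirFree H) => (1 / 2 : ℝ) * ∑ c, (G' c + dirCirc H q' (t c)) ^ 2)
      (Measure.pi fun _ : Fin D => boxDirichlet H) := (memLp_two_quadObs_piD (H := H) G' q').aestronglyMeasurable
  obtain ⟨hQ₁₂, hprod⟩ := memLp_two_mul_of_integrable_pow_four (μ := Measure.pi fun _ : Fin D => boxDirichlet H) hm₁ hm₂ hI₁ hI₂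
  have hK₁₂ : ∫ t, (((1 / 2 : ℝ) * ∑ c, (F c + dirCirc H p' (t c)) ^ 2) * ((1 / 2 : ℝ) * ∑ c, (G' c + dirCirc H q' (t c)) ^ 2)) ^ 2
        ∂(Measure.pi fun _ : Fin D => boxDirichlet H) ≤
      Real.sqrt ((8 * (D : ℝ) ^ 3 * ∑ c, (F c ^ 8 + 105 * boxDirProjKernel H p' p' ^ 4) +
        8 * (D : ℝ) ^ 3 * ∑ c, (G' c ^ 8 + 105 * boxDirProjKernel H q' q' ^ 4)) / 2) ^ 2 := by
    rw [Real.sq_sqrt hAB'0]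
    refine hprod.trans ?_
    have hsum := add_le_add h4₁ h4₂
    linarith
  have h := abs_kernelCovG_sub_gaussian_le_core₂ ρ hρc ω x y i j k l hE hE0 hpY hM hfM hgM cfg hcfg hS hS0 hp hWm hW hRepF hRepG hRepFG
    F G' p' q' hτ (Real.sqrt_nonneg _) (Real.sqrt_nonneg _) hFS hGS hSurF hSurG hQ₁₂ hK₁ hK₂ hK₁₂
  rw [Real.sq_sqrt hAB0] at h
  exact h

end Summit.QuantumFields.YangMills.Theorems.ColdBoxAllGroups

end
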